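import Summits.CriticalPhenomena.PercolationContinuityZ3.Theorems.PercNearOneGluingNoHeavyLowerTailAntitheticTwoStageGraph
import Summits.CriticalPhenomena.PercolationContinuityZ3.Theorems.PercNearOneGluingNoHeavyLowerTailAntitheticTwoStageFan
import HarnessLib

/-!
# `NoHeavyLowerTail` (stmt-CriticalPhenomena-4575) — antithetic cluster pairs: **THEOREM FAT** and the apex ∥ fan family
# (HOME/THEOREM-FAT.md, prim-hp-2 gen 59)

Support file (`--supports stmt-CriticalPhenomena-4575`, hull-port prover `prim-hp-2`, gen 59).  No definitions, no named facts, no sorries;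
standard axioms.  VERTEX version.

* `Antithetic.TwoStage.nested_of_apex`: hypothesis (H1) of THEOREM 2H holds for every side `G₁` on `{s, y} ∪ W` in which `y` is adjacent to `s`
  and to every vertex of `W` (if `sy` is red and `y` is not blue-reached, every blue-reached vertex is red-reached through `y`).
* **`Antithetic.TwoStage.apexFan_vertex_sum_nonneg`**: for such a `G₁` (ANY further edges among `{s} ∪ W`), `G₂` = a fan `s * K_{1,|L|}` with hub `z`,
  and `x` joined to `y` and `z`: the vertex antithetic inequality at `R = {x}`,
  `0 ≤ Σ_{ω : ¬(x ∈ X ω ∧ x ∈ Y ω)} (F(X ω) − F(Y ω))(G(X ω) − G(Y ω))` for all monotone `F, G` (`TwoStage.vertex_sum_nonneg` +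
  `nested_of_apex` + `Fan.R_associated`).
* **`Antithetic.TwoStage.fat_vertex_sum_nonneg` (THEOREM FAT(L₁,L₂), all leaf sets)**: both sides fans.  For `|L₁|, |L₂| ≥ 6` BOTH one-sided
  terms of deg-2 elimination are negative (THEOREM FAN, HOME/THEOREM-Fans.md) — the first tree theorem that uses TERM I's slack.
[cite: VandenbergHaggstromKahn2005, §1 p. 6 ("Harris' inequality"), §1 p. 3 (open cluster `C_s`)]
-/

noncomputable section

namespace Summit.CriticalPhenomena.PercolationContinuityZ3.Theorems

open Literature.Probability.Percolation
open scoped Classical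

namespace Antithetic

namespace TwoStage

variable {V : Type*}

/-- **(H1) for apex sides.**  If every pair of `E₁` lies in `{s, y} ∪ W`, `sy ∈ E₁` and `yw ∈ E₁` for all `w ∈ W`, then for every colouring with
`sy` red and `y` not blue-reached, the blue cluster of `s` is contained in the red one. [this work] -/
theorem nested_of_apex (E₁ : Set (Sym2 V)) (s y : V) (W : Set V) (hW : ∀ e ∈ E₁, ∀ v ∈ e, v = s ∨ v ∈ ({v | v = y ∨ v ∈ W} : Set V))
    (hsy : s(s, y) ∈ E₁) (hyw : ∀ w ∈ W, s(y, w) ∈ E₁) (ω : Set (Sym2 V)) (hred : s(s, y) ∈ ω)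
    (hy : y ∉ openCluster (ωᶜ ∩ E₁) s) : openCluster (ωᶜ ∩ E₁) s ⊆ openCluster (ω ∩ E₁) s := by
  intro v hv
  have hyX : y ∈ openCluster (ω ∩ E₁) s := Freeze.mem_cluster_of_edge (mem_openCluster_self _ _) ⟨hred, hsy⟩
  rcases Set.mem_insert_iff.1 (Cut.cluster_subset_side hW ωᶜ hv) with rfl | (rfl | hvW)
  · exact mem_openCluster_self _ _
  · exact absurd hv hy
  · by_cases h : s(y, v) ∈ ω
    · exact Freeze.mem_cluster_of_edge hyX ⟨h, hyw v hvW⟩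
    · have h' : s(v, y) ∈ ωᶜ ∩ E₁ := by rw [Sym2.eq_swap]; exact ⟨h, hyw v hvW⟩
      exact absurd (Freeze.mem_cluster_of_edge hv h') hy

variable [Fintype V]

/-- **Apex side ∥ fan** (THEOREM 2H instantiated): `G₁` any graph on `{s, y} ∪ W` with `y ~ s` and `y ~ w` for all `w ∈ W`; `G₂` the fan with hub
`z` and leaves `L`; `x ~ y, z`.  The vertex antithetic inequality at `R = {x}`. [this work] -/
theorem apexFan_vertex_sum_nonneg (E E₁ E₂ : Set (Sym2 V)) (s x y z : V) (W : Set V) (L : Finset V)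
    (hsx : s ≠ x) (hsy : s ≠ y) (hsz : s ≠ z) (hxy : x ≠ y) (hxz : x ≠ z) (hyz : y ≠ z)
    (hsW : s ∉ W) (hxW : x ∉ W) (hyW : y ∉ W) (hzW : z ∉ W) (hsL : s ∉ L) (hxL : x ∉ L) (hyL : y ∉ L) (hzL : z ∉ L)
    (hWL : ∀ v ∈ W, v ∉ L)
    (hE₁ : ∀ e ∈ E₁, ∀ v ∈ e, v = s ∨ v ∈ ({v | v = y ∨ v ∈ W} : Set V)) (hsyE : s(s, y) ∈ E₁) (hyw : ∀ w ∈ W, s(y, w) ∈ E₁)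
    (hE₂ : ∀ e, e ∈ E₂ ↔ e = s(s, z) ∨ ∃ ℓ ∈ L, e = s(s, ℓ) ∨ e = s(z, ℓ))
    (hE : ∀ e, e ∈ E ↔ e ∈ E₁ ∨ e ∈ E₂ ∨ e = s(x, y) ∨ e = s(x, z))
    {F G : Set V → ℝ} (hF : Monotone F) (hG : Monotone G) :
    0 ≤ ∑ ω ∈ Finset.univ.filter (fun ω : Set (Sym2 V) =>
        ¬ ((openGraph (ω ∩ E)).Reachable s x ∧ (openGraph (ωᶜ ∩ E)).Reachable s x)),
      (F (openCluster (ω ∩ E) s) - F (openCluster (ωᶜ ∩ E) s)) * (G (openCluster (ω ∩ E) s) - G (openCluster (ωᶜ ∩ E) s)) := by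
  have hside₂ : ∀ e ∈ E₂, ∀ v ∈ e, v = s ∨ v ∈ ({v | v = z ∨ v ∈ L} : Set V) := by
    intro e he v hv
    rcases (hE₂ e).1 he with rfl | ⟨ℓ, hℓ, rfl | rfl⟩
    · rcases Sym2.mem_iff.1 hv with rfl | rfl
      · exact Or.inl rfl
      · exact Or.inr (Or.inl rfl)
    · rcases Sym2.mem_iff.1 hv with rfl | rfl
      · exact Or.inl rfl
      · exact Or.inr (Or.inr hℓ)
    · rcases Sym2.mem_iff.1 hv with rfl | rfl
      · exact Or.inr (Or.inl rfl)
      · exact Or.inr (Or.inr hℓ)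
  -- `x` occurs in neither side
  have hx₁ : ∀ e ∈ E₁, x ∉ e := fun e he hx => by
    rcases hE₁ e he x hx with h | (h | h)
    · exact hsx h.symm
    · exact hxy h
    · exact hxW h
  have hx₂ : ∀ e ∈ E₂, x ∉ e := fun e he hx => by
    rcases hside₂ e he x hx with h | (h | h)
    · exact hsx h.symm
    · exact hxz h
    · exact hxL h
  have he : s(x, y) ∈ E := (hE _).2 (Or.inr (Or.inr (Or.inl rfl)))
  have hf : s(x, z) ∈ E := (hE _).2 (Or.inr (Or.inr (Or.inr rfl)))
  have hdeg : ∀ h ∈ E, x ∈ h → h = s(x, y) ∨ h = s(x, z) := by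
    intro h hh hxh
    rcases (hE h).1 hh with h1 | h1 | h1 | h1
    · exact absurd hxh (hx₁ h h1)
    · exact absurd hxh (hx₂ h h1)
    · exact Or.inl h1
    · exact Or.inr h1
  have hU : Disjoint ({v | v = y ∨ v ∈ W} : Set V) {v | v = z ∨ v ∈ L} := by
    rw [Set.disjoint_left]
    rintro v (rfl | hv) (h | h)
    · exact hyz h
    · exact hyL h
    · exact hzW (h ▸ hv)
    · exact hWL v hv h
  have hs₁ : s ∉ ({v | v = y ∨ v ∈ W} : Set V) := by rintro (h | h); exacts [hsy h, hsW h]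
  have hs₂ : s ∉ ({v | v = z ∨ v ∈ L} : Set V) := by rintro (h | h); exacts [hsz h, hsL h]
  have hdis : Disjoint E₁ E₂ := by
    rw [Set.disjoint_left]
    intro e he₁ he₂
    -- a pair of `E₁ ∩ E₂` has all entries in `{s}`: impossible for a non-diagonal fan pair
    rcases (hE₂ e).1 he₂ with rfl | ⟨ℓ, hℓ, rfl | rfl⟩
    · rcases hE₁ _ he₁ z (Sym2.mem_mk_right _ _) with h | h
      · exact hsz h.symm
      · exact Set.disjoint_left.1 hU h (Or.inl rfl)
    · rcases hE₁ _ he₁ ℓ (Sym2.mem_mk_right _ _) with h | h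
      · exact hsL (h ▸ hℓ)
      · exact Set.disjoint_left.1 hU h (Or.inr hℓ)
    · rcases hE₁ _ he₁ z (Sym2.mem_mk_left _ _) with h | h
      · exact hsz h.symm
      · exact Set.disjoint_left.1 hU h (Or.inl rfl)
  have hg : s(y, z) ∉ E := by
    intro h
    rcases (hE _).1 h with h1 | h1 | h1 | h1
    · rcases hE₁ _ h1 z (Sym2.mem_mk_right _ _) with h2 | h2
      · exact hsz h2.symm
      · exact Set.disjoint_left.1 hU h2 (Or.inl rfl)
    · rcases hside₂ _ h1 y (Sym2.mem_mk_left _ _) with h2 | h2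
      · exact hsy h2.symm
      · exact Set.disjoint_right.1 hU h2 (Or.inl rfl)
    · rw [Sym2.eq_iff] at h1
      rcases h1 with ⟨h2, _⟩ | ⟨_, h2⟩
      · exact hxy h2.symm
      · exact hxz h2.symm
    · rw [Sym2.eq_iff] at h1
      rcases h1 with ⟨h2, _⟩ | ⟨h2, _⟩
      · exact hxy h2.symm
      · exact hyz h2
  have hE' : E \ {s(x, y), s(x, z)} = E₁ ∪ E₂ := by
    ext e
    simp only [Set.mem_sdiff, Set.mem_insert_iff, Set.mem_singleton_iff, Set.mem_union, not_or]
    constructor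
    · rintro ⟨heE, h1, h2⟩
      rcases (hE e).1 heE with h | h | h | h
      · exact Or.inl h
      · exact Or.inr h
      · exact absurd h h1
      · exact absurd h h2
    · intro h
      refine ⟨(hE e).2 (h.elim Or.inl (fun h => Or.inr (Or.inl h))), fun h1 => ?_, fun h2 => ?_⟩
      · rcases h with h | h
        · exact hx₁ e h (h1 ▸ Sym2.mem_mk_left x y)
        · exact hx₂ e h (h1 ▸ Sym2.mem_mk_left x y)
      · rcases h with h | h
        · exact hx₁ e h (h2 ▸ Sym2.mem_mk_left x z)
        · exact hx₂ e h (h2 ▸ Sym2.mem_mk_left x z)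
  exact vertex_sum_nonneg hsx.symm hxy hxz hyz he hf hdeg hg E₁ E₂ {v | v = y ∨ v ∈ W} {v | v = z ∨ v ∈ L} hE' hU hs₁ hs₂
    hE₁ hside₂ hdis (Or.inl rfl) (Or.inl rfl) hsyE
    (fun ω hω hyY => nested_of_apex E₁ s y W hE₁ hsyE hyw ω hω hyY)
    (fun Φ₁ Φ₂ hΦ₁ hΦ₂ => Fan.R_associated E₂ s z L hsz hsL hzL hE₂ Φ₁ Φ₂ hΦ₁ hΦ₂) hF hG

/-- **THEOREM FAT** (HOME/THEOREM-FAT.md): the vertex antithetic inequality at `R = {x}` on `FAT(L₁, L₂)` (two fans at `s` with hubs `y`, `z`,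
`x ~ y, z`) for ALL leaf sets `L₁, L₂`. [this work] -/
theorem fat_vertex_sum_nonneg (E E₁ E₂ : Set (Sym2 V)) (s x y z : V) (L₁ L₂ : Finset V)
    (hsx : s ≠ x) (hsy : s ≠ y) (hsz : s ≠ z) (hxy : x ≠ y) (hxz : x ≠ z) (hyz : y ≠ z)
    (hsL₁ : s ∉ L₁) (hsL₂ : s ∉ L₂) (hxL₁ : x ∉ L₁) (hxL₂ : x ∉ L₂) (hyL₁ : y ∉ L₁) (hyL₂ : y ∉ L₂) (hzL₁ : z ∉ L₁) (hzL₂ : z ∉ L₂)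
    (hL : Disjoint L₁ L₂)
    (hE₁ : ∀ e, e ∈ E₁ ↔ e = s(s, y) ∨ ∃ ℓ ∈ L₁, e = s(s, ℓ) ∨ e = s(y, ℓ))
    (hE₂ : ∀ e, e ∈ E₂ ↔ e = s(s, z) ∨ ∃ ℓ ∈ L₂, e = s(s, ℓ) ∨ e = s(z, ℓ))
    (hE : ∀ e, e ∈ E ↔ e ∈ E₁ ∨ e ∈ E₂ ∨ e = s(x, y) ∨ e = s(x, z))
    {F G : Set V → ℝ} (hF : Monotone F) (hG : Monotone G) :
    0 ≤ ∑ ω ∈ Finset.univ.filter (fun ω : Set (Sym2 V) =>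
        ¬ ((openGraph (ω ∩ E)).Reachable s x ∧ (openGraph (ωᶜ ∩ E)).Reachable s x)),
      (F (openCluster (ω ∩ E) s) - F (openCluster (ωᶜ ∩ E) s)) * (G (openCluster (ω ∩ E) s) - G (openCluster (ωᶜ ∩ E) s)) := by
  have hside₁ : ∀ e ∈ E₁, ∀ v ∈ e, v = s ∨ v ∈ ({v | v = y ∨ v ∈ (↑L₁ : Set V)} : Set V) := by
    intro e he v hv
    rcases (hE₁ e).1 he with rfl | ⟨ℓ, hℓ, rfl | rfl⟩
    · rcases Sym2.mem_iff.1 hv with rfl | rfl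
      · exact Or.inl rfl
      · exact Or.inr (Or.inl rfl)
    · rcases Sym2.mem_iff.1 hv with rfl | rfl
      · exact Or.inl rfl
      · exact Or.inr (Or.inr (Finset.mem_coe.2 hℓ))
    · rcases Sym2.mem_iff.1 hv with rfl | rfl
      · exact Or.inr (Or.inl rfl)
      · exact Or.inr (Or.inr (Finset.mem_coe.2 hℓ))
  refine apexFan_vertex_sum_nonneg E E₁ E₂ s x y z (↑L₁ : Set V) L₂ hsx hsy hsz hxy hxz hyz
    (fun h => hsL₁ (Finset.mem_coe.1 h)) (fun h => hxL₁ (Finset.mem_coe.1 h)) (fun h => hyL₁ (Finset.mem_coe.1 h))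
    (fun h => hzL₁ (Finset.mem_coe.1 h)) hsL₂ hxL₂ hyL₂ hzL₂ (fun v hv h => Finset.disjoint_left.1 hL (Finset.mem_coe.1 hv) h)
    hside₁ ((hE₁ _).2 (Or.inl rfl)) (fun w hw => (hE₁ _).2 (Or.inr ⟨w, Finset.mem_coe.1 hw, Or.inr rfl⟩)) hE₂ hE hF hG

end TwoStage

end Antithetic

end Summit.CriticalPhenomena.PercolationContinuityZ3.Theorems
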